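import Summits.QuantumFields.YangMills.Theorems.BalabanUVNodesPortS1RecordDtUniform
import Summits.QuantumFields.YangMills.Theorems.BalabanUVNodesPortS1ChartConstraint
import Summits.QuantumFields.YangMills.Theorems.BalabanUVNodesK0RecordFormatNamesFluctG

/-!
# Port S1, (T1) brick (B-e)₀ — THE TRANSLATED, SCALED GRAPH POINT LIES ON THE FIBRE: for `B = g·C·B_rem` (`C = recordCopFluct`, the elimination operator on `FluctIdx`) the real point
# `Y_g = B − hD̃(B)` (✓ DEF-1 `recordReparamOf` at `Dt := recordDt … ρ₀`) satisfies `Q̃(V^{(k)}, Y_g) = 0`, i.e. `Ū(V′_{Y_g}V^{(k)}) = Ū(V^{(k)})` — [I] p.267–268 «the above change of variables yields the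
# integral with the δ-function δ(Q̃B) … B′ = CB, C … determined by the condition that it is a linear parametrization of the space of solutions of Q̃B′ = 0»

Cell `ym-nodeO-ideate`, porter seat PT-A-1 (gen 10); `--kind proof --supports stmt-QuantumFields-27930 --as helper`; count-neutral.  [I] = [Balaban1987RG1]; [15] = [Balaban1985Variational].
`CHART-LAW-PROOF-PLAN-v1.md` §2 brick towards (L3-e) («(L1)'s ϑ_c = the explicit solved coordinate»: with ✓`…N09CentralWindowAtRecord` :158 (ϑ is THE inverse on the window) this file's §3 identifies them);
inputs ✓`recordQtC_sub_hop_recordDt_uniform_eq` (the linearisation at the pinned radius), ✓`recordLQtC_ofReal`, ✓`ofReal_recordReparamOf_recordDt`∕`recordQtC_ofReal_of_norm_lt`∕`window_fiftieth_of_oneStep` (reality),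
✓`recordQt_eq_zero_iff` (p826509), ✓`recordLQtB0_mul_recordXLoc` (`A₁X = A₂`), DEF-1 ✓`recordCopFluct` (§24l).

WHAT IS PROVED (`ρ₀ = ρ₀(d,L,α)` of ✓`recordDt_spec_uniform`, one currency `dist1(loops of Vk) ≤ α`, `157α < L^{1−d}`):
* §1 `recordCopFluct_apply_b0`, `recordCopFluct_apply_of_not_mem`; ★ `recordLQtMat_mul_recordCopFluct` — `LQ̃·C = A₁(−A₁⁻¹A₂) + A₂ = 0` on `FluctIdx` rows (sum split along `blkToFluct`); ★ `recordLQt_recordCopFluct_mulVec`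
  — `LQ̃(V^{(k)})(C·y) = 0` (𝔰𝔲(2)-valued with all 𝔰𝔲(2)-coordinates zero); `recordLQtC_ofReal_smul_recordCopFluct_mulVec` (complex side, any real scale `g`).
* §2 ★★★ `recordQt_recordReparamOf_recordCopFluct_eq_zero` — `Q̃(V^{(k)}, Y_g(C·y)) = 0` at every coarse bond for `‖↑(g·C·y)‖ < ρ₀`: `Q̃_ℂ(Φ B) = LQ̃_ℂ B = 0` at `B = ↑(g·C·y)` and `Φ(↑(g·C·y)) = ↑Y_g` is REAL.
* §3 ★★★ `avg_pert_recordReparamOf_recordCopFluct_eq` — `Ū(V′_{Y_g(C·y)}·V^{(k)})(c) = Ū(V^{(k)})(c)`: the translated graph point is ON THE FIBRE (series-log window `≤ 1∕50` at the real point, ✓`window_fiftieth_of_oneStep`);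
  with ✓`…N09CentralWindowAtRecord` :158 this pins (L1)'s `ϑ_c` to the explicit solved coordinate (the (L3-e) glue proper is the next brick).

HONEST FRAMING.  Algebra + the landed linearisation∕reality bricks; nothing of Bałaban's renormalization-group estimates asserted, ported or discharged; the chart law (T1) itself, (P-γ), (L3-d′), (T2) NOT here;
`FEChartLawStep`∕`FEStepBox`∕`P0FamilySupply` inhabited nowhere; `stub_P0C`∕`stub_FE(step)` OPEN; ⟨27930⟩ OPEN 1∕3; NODE O 0∕1; COUNT 8∕28 · K 1∕4 UNMOVED; finite `𝕋⁴_{L^K}` at fixed ε — NOT continuum ∕ OS;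
**the Yang–Mills mass gap (Clay) is NOT proved by any of this.**  No `sorry`, no `def`, no `instance`; standard axioms only.
-/

noncomputable section

open scoped BigOperators Matrix.Norms.L2Operator Topology

open Set Metric Filter

namespace Summit.QuantumFields.YangMills.Theorems.BalabanUVNodesPortS1

open Summit.QuantumFields.YangMills.Theorems.K0RecordFormatNames
open Literature.MathematicalPhysics.QuantumFieldTheory.Balaban1983to89
open Literature.MathematicalPhysics.QuantumFieldTheory.Balaban1983to89.Node00
open Literature.MathematicalPhysics.QuantumFieldTheory.Balaban1983to89.T4Continuum (T4Family)
open Literature.MathematicalPhysics.QuantumFieldTheory.Balaban1983to89.T4AdjointCovarianceUnitary (lieSU)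
open Literature.MathematicalPhysics.QuantumFieldTheory.Balaban1983to89.B15AveragingHolomorphic (avgMh coe_avgFun_eq_avgMh)
open Literature.MathematicalPhysics.QuantumFieldTheory.Balaban1983to89.BlockAveraging (avgFun loopHol Small Idx)
open Literature.MathematicalPhysics.QuantumFieldTheory.Balaban1983to89.ExpMeanLog (expMeanLogSU)
open _root_.Matrix

variable (F : T4Family)

/-! ## §1  `LQ̃ · C = 0` on `FluctIdx` rows -/

open Classical in
/-- The elimination operator at a `b₀`-row reads `−X`. [cite: Balaban1987RG1, p.268 («B′ = CB»)] -/
theorem recordCopFluct_apply_b0 (k K : ℕ) (hk : k + 1 ≤ (F.P K).m + (F.P K).K) (Vk : GaugeField (F.P K) k (SU 2)) (cj : CoarseIdx F k K) (j : NonB0Idx F k K) :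
    recordCopFluct F k K Vk (recordB0 F k K cj.1, cj.2) j = -(recordXLoc F k K Vk cj j) := by
  have hmem : (recordB0 F k K cj.1, cj.2).1 ∈ Set.range (recordB0 F k K) := ⟨cj.1, rfl⟩
  have hch : hmem.choose = cj.1 := BlockAveragingHaarAC.centralBond_injective hk hmem.choose_spec
  show (if h : (recordB0 F k K cj.1, cj.2).1 ∈ Set.range (recordB0 F k K) then -(recordXLoc F k K Vk (h.choose, cj.2) j)
    else if (⟨(recordB0 F k K cj.1, cj.2), h⟩ : NonB0Idx F k K) = j then 1 else 0) = _
  rw [dif_pos hmem, hch]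

open Classical in
/-- The elimination operator at a non-`b₀` row is the identity block. [cite: Balaban1987RG1, p.268 («Denoting the remaining variables by B»)] -/
theorem recordCopFluct_apply_of_not_mem (k K : ℕ) (Vk : GaugeField (F.P K) k (SU 2)) (i j : NonB0Idx F k K) :
    recordCopFluct F k K Vk i.1 j = if i = j then 1 else 0 := by
  show (if h : i.1.1 ∈ Set.range (recordB0 F k K) then -(recordXLoc F k K Vk (h.choose, i.1.2) j)
    else if (⟨i.1, h⟩ : NonB0Idx F k K) = j then 1 else 0) = _
  rw [dif_neg i.2]

open Classical in
/-- ★ **`LQ̃ · C = 0`**: `recordLQtMat Vk * recordCopFluct Vk = 0` under `RecordB0BlockInvertible` (`A₁·(−A₁⁻¹A₂) + A₂ = 0`, sum over `FluctIdx` split along the bijection `blkToFluct`).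
[cite: Balaban1987RG1, p.268 («a linear parametrization of the space of solutions of Q̃B′ = 0»)] -/
theorem recordLQtMat_mul_recordCopFluct (k K : ℕ) (hk : k + 1 ≤ (F.P K).m + (F.P K).K) (Vk : GaugeField (F.P K) k (SU 2)) (hA : RecordB0BlockInvertible F k K Vk) :
    recordLQtMat F k K Vk * recordCopFluct F k K Vk = 0 := by
  ext cj j
  rw [Matrix.mul_apply, Matrix.zero_apply,
    ← (blkToFluct_bijective F k K hk).sum_comp (fun i => recordLQtMat F k K Vk cj i * recordCopFluct F k K Vk i j), Fintype.sum_sum_type]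
  have h1 : ∑ c'j' : CoarseIdx F k K, recordLQtMat F k K Vk cj (blkToFluct F k K (Sum.inl c'j')) * recordCopFluct F k K Vk (blkToFluct F k K (Sum.inl c'j')) j =
      -((recordLQtB0 F k K Vk * recordXLoc F k K Vk) cj j) := by
    rw [Matrix.mul_apply, ← Finset.sum_neg_distrib]
    refine Finset.sum_congr rfl fun c'j' _ => ?_
    show recordLQtMat F k K Vk cj (recordB0 F k K c'j'.1, c'j'.2) * recordCopFluct F k K Vk (recordB0 F k K c'j'.1, c'j'.2) j = _
    rw [recordCopFluct_apply_b0 F k K hk Vk c'j' j, mul_neg]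
    rfl
  have h2 : ∑ i : NonB0Idx F k K, recordLQtMat F k K Vk cj (blkToFluct F k K (Sum.inr i)) * recordCopFluct F k K Vk (blkToFluct F k K (Sum.inr i)) j =
      recordLQtOff F k K Vk cj j := by
    rw [Finset.sum_eq_single j]
    · show recordLQtMat F k K Vk cj j.1 * recordCopFluct F k K Vk j.1 j = _
      rw [recordCopFluct_apply_of_not_mem, if_pos rfl, mul_one]; rfl
    · intro i _ hij
      show recordLQtMat F k K Vk cj i.1 * recordCopFluct F k K Vk i.1 j = 0
      rw [recordCopFluct_apply_of_not_mem, if_neg hij, mul_zero]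
    · intro h; exact absurd (Finset.mem_univ j) h
  rw [h1, h2, recordLQtB0_mul_recordXLoc F k K Vk hA, neg_add_cancel]

/-- ★ **`LQ̃(V^{(k)})(C·y) = 0`** for every `y : NonB0Idx → ℝ`, under the (0.4) guard and `RecordB0BlockInvertible` (all 𝔰𝔲(2)-coordinates vanish and the value is 𝔰𝔲(2)-valued).
[cite: Balaban1987RG1, p.268 («the space of solutions of Q̃B′ = 0»)] -/
theorem recordLQt_recordCopFluct_mulVec (k K : ℕ) (hk : k + 1 ≤ (F.P K).m + (F.P K).K) (Vk : GaugeField (F.P K) k (SU 2)) (hVk : ∀ c, Small expMeanLogSU Vk c)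
    (hA : RecordB0BlockInvertible F k K Vk) (y : NonB0Idx F k K → ℝ) :
    recordLQt F k K Vk (recordCopFluct F k K Vk *ᵥ y) = 0 := by
  funext c
  refine eq_zero_of_mem_lieSU_of_su2Coord (recordLQt_mem_lieSU_of_small F k K Vk hVk _ c) fun j => ?_
  rw [← recordLQtMat_mulVec F k K Vk _ (c, j), Matrix.mulVec_mulVec, recordLQtMat_mul_recordCopFluct F k K hk Vk hA, Matrix.zero_mulVec]
  rfl

/-- `LQ̃_ℂ(V^{(k)})(↑(g·C·y)) = 0` (complex side: ✓`recordLQtC_ofReal` + linearity). [cite: Balaban1987RG1, p.267–268] -/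
theorem recordLQtC_ofReal_smul_recordCopFluct_mulVec (k K : ℕ) (hk : k + 1 ≤ (F.P K).m + (F.P K).K) (Vk : GaugeField (F.P K) k (SU 2)) {ε : ℝ}
    (hε : ∀ (c : PBond (F.P K) (k + 1)) (i : Idx (F.P K)), ‖loopM (coeField Vk) c i - 1‖ ≤ ε) (hε50 : ε ≤ 1 / 50)
    (hVk : ∀ c, Small expMeanLogSU Vk c) (hA : RecordB0BlockInvertible F k K Vk) (g : ℝ) (y : NonB0Idx F k K → ℝ) :
    recordLQtC F k K Vk (fun i => (((g • (recordCopFluct F k K Vk *ᵥ y)) i : ℝ) : ℂ)) = 0 := by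
  rw [recordLQtC_ofReal F k K hk Vk hε hε50 hVk, map_smul, recordLQt_recordCopFluct_mulVec F k K hk Vk hVk hA, smul_zero]

/-! ## §2  `Q̃(V^{(k)}, Y_g(C·y)) = 0` at the pinned radius -/

variable {F} in
/-- ★★★ **THE TRANSLATED, SCALED GRAPH POINT SOLVES THE CONSTRAINT**: for `y : NonB0Idx → ℝ`, `g : ℝ` with `‖↑(g·C·y)‖ < ρ₀(d,L,α)`, the real point `Y_g := recordReparamOf … (recordDt … ρ₀) Vk g (C·y)`
satisfies `recordQt Vk Y_g c = 0` at every coarse bond: `Q̃_ℂ(Φ(↑(g·C·y))) = LQ̃_ℂ(↑(g·C·y)) = 0` (✓`recordQtC_sub_hop_recordDt_uniform_eq` + §1) and `Φ(↑(g·C·y)) = ↑Y_g` is a REAL point of norm `< 2ρ₀ ≤ R`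
where `Q̃_ℂ(↑·) = Q̃(·)`. [cite: Balaban1987RG1, p.267 («linearizes the function Q̃»), p.268 («B′ = CB»)] -/
theorem recordQt_recordReparamOf_recordCopFluct_eq_zero {k K : ℕ} (hk : k + 1 ≤ (F.P K).m + (F.P K).K) (Vk : GaugeField (F.P K) k (SU 2)) {α : ℝ}
    (hα : ∀ (c : PBond (F.P K) (k + 1)) (i : Idx (F.P K)), dist1 (loopHol Vk c i) ≤ α) (hαL : 157 * α < (((F.P K).L : ℝ) ^ ((F.P K).d - 1))⁻¹)
    (g : ℝ) (y : NonB0Idx F k K → ℝ) (hgy : ‖(fun i => ((g • (recordCopFluct F k K Vk *ᵥ y)) i : ℂ))‖ < (min ((1 : ℝ) / (10 ^ 8 * (F.P K).d * (F.P K).L) / 3) (1 / (18 * (2 * 1 / (1 / (10 ^ 8 * (F.P K).d * (F.P K).L)) ^ 2) * ((6 / ((((F.P K).L : ℝ) ^ ((F.P K).d - 1))⁻¹ - 157 * α)) + 1))))) (c : PBond (F.P K) (k + 1)) :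
    recordQt F k K Vk (recordReparamOf F k (fun Vk => recordDt F k K Vk (min ((1 : ℝ) / (10 ^ 8 * (F.P K).d * (F.P K).L) / 3) (1 / (18 * (2 * 1 / (1 / (10 ^ 8 * (F.P K).d * (F.P K).L)) ^ 2) * ((6 / ((((F.P K).L : ℝ) ^ ((F.P K).d - 1))⁻¹ - 157 * α)) + 1))))) Vk g (recordCopFluct F k K Vk *ᵥ y)) c = 0 := by
  have hα50 : α ≤ 1 / 50 := alpha_le_fiftieth_of_lt F K hαL
  have hα24 : α ≤ 1 / 24 := hα50.trans (by norm_num)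
  have hθ : 0 < (((F.P K).L : ℝ) ^ ((F.P K).d - 1))⁻¹ - 157 * α := sub_pos.2 hαL
  have hb : (0 : ℝ) ≤ 6 / ((((F.P K).L : ℝ) ^ ((F.P K).d - 1))⁻¹ - 157 * α) := by positivity
  have hd : (1 : ℝ) ≤ (F.P K).d := by exact_mod_cast (F.P K).hd
  have hL : (1 : ℝ) ≤ (F.P K).L := by exact_mod_cast (F.P K).hL.2.le
  have hR : (0 : ℝ) < 1 / (10 ^ 8 * (F.P K).d * (F.P K).L) := by positivity
  have hC₂ : (0 : ℝ) < 2 * 1 / (1 / (10 ^ 8 * (F.P K).d * (F.P K).L)) ^ 2 := by positivity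
  obtain ⟨_, hq, h3⟩ := recordDt_smallness_of_radius hR hC₂ hb
  have hε := norm_loopM_sub_one_le_of_dist1 F Vk hα
  have hVk := small_of_dist1_le F Vk hα hα50
  have hHop := norm_hopLinGraphC_le F k K hk Vk hα hα24 hαL
  have hA := recordB0BlockInvertible_of_loopSmall F k K hk Vk hα hα24 hαL
  -- the linearisation at `B = ↑(g·C·y)` and `LQ̃_ℂ(↑(g·C·y)) = 0`
  have hlin := recordQtC_sub_hop_recordDt_uniform_eq F k K hk Vk hα hαL hgy
  rw [recordLQtC_ofReal_smul_recordCopFluct_mulVec F k K hk Vk hε hα50 hVk hA g y] at hlin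
  -- `Φ(↑(g·C·y)) = ↑Y_g`, a real point of norm `< 2ρ₀ ≤ R`
  rw [← ofReal_recordReparamOf_recordDt hk Vk hε hα50 hVk hb hHop hq h3 g (recordCopFluct F k K Vk *ᵥ y) hgy] at hlin
  have hY2 := norm_ofReal_recordReparamOf_recordDt_lt hk Vk hε hα50 hVk hb hHop hq h3 g (recordCopFluct F k K Vk *ᵥ y) hgy
  have hYR : ‖(recordReparamOf F k (fun Vk => recordDt F k K Vk (min ((1 : ℝ) / (10 ^ 8 * (F.P K).d * (F.P K).L) / 3) (1 / (18 * (2 * 1 / (1 / (10 ^ 8 * (F.P K).d * (F.P K).L)) ^ 2) * ((6 / ((((F.P K).L : ℝ) ^ ((F.P K).d - 1))⁻¹ - 157 * α)) + 1))))) Vk g (recordCopFluct F k K Vk *ᵥ y))‖ < 1 / (10 ^ 8 * (F.P K).d * (F.P K).L) := by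
    rw [← norm_ofReal_pi_eq]; linarith [norm_nonneg (fun i => ((g • (recordCopFluct F k K Vk *ᵥ y)) i : ℂ))]
  rw [recordQtC_ofReal_of_norm_lt F k K hk Vk hε hα50 hVk _ hYR] at hlin
  exact congrFun hlin c

/-! ## §3  Hence the point is on the fibre: `Ū(V′_{Y_g}V^{(k)}) = Ū(V^{(k)})` -/

/-- The series-log window at a REAL point of the ball: `‖Ū(pert Vk x)(c)·Ū(Vk)(c)⁻¹ − 1‖ ≤ 1∕50` for `‖x‖ < R` (✓`window_fiftieth_of_oneStep` at `z = ↑x`). [cite: Balaban1987RG1, (2.4) p.266] -/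
theorem norm_avg_pert_mul_inv_sub_one_le (k K : ℕ) (hk : k + 1 ≤ (F.P K).m + (F.P K).K) (Vk : GaugeField (F.P K) k (SU 2)) {ε : ℝ}
    (hε : ∀ (c : PBond (F.P K) (k + 1)) (i : Idx (F.P K)), ‖loopM (coeField Vk) c i - 1‖ ≤ ε) (hε50 : ε ≤ 1 / 50)
    (hVk : ∀ c, Small expMeanLogSU Vk c) (x : FluctIdx F k K → ℝ) (hx : ‖x‖ < 1 / (10 ^ 8 * (F.P K).d * (F.P K).L)) (c : PBond (F.P K) (k + 1)) :
    ‖((((avOfRecord F 2 K k).avg (pert F k K Vk x) c * ((avOfRecord F 2 K k).avg Vk c)⁻¹ : SU 2) : MatA 2)) - 1‖ ≤ 1 / 50 := by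
  have hsmall := small_pert_of_norm_lt F k K hk Vk hε hε50 hVk x hx c
  have hz : ‖(fun j => (x j : ℂ))‖ < 1 / (10 ^ 8 * (F.P K).d * (F.P K).L) := (norm_ofReal_pi_le x).trans_lt hx
  have hsum := phi_add_lam_le_of_norm_le (F.P K).hd (F.P K).hL.2.le (norm_nonneg (fun j => (x j : ℂ))) hz.le
  have hW := window_fiftieth_of_oneStep F k K hk Vk (fun j => (x j : ℂ)) (norm_pertC_mul_star_sub_one_le F k K Vk _) le_rfl le_rfl hε hsum hε50 c (hVk c)
  rw [pertC_ofReal, ← coe_avgFun_eq_avgMh (pert F k K Vk x) c hsmall, ← coe_inv_SU, ← Submonoid.coe_mul] at hW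
  exact hW

variable {F} in
/-- ★★★ **THE TRANSLATED, SCALED GRAPH POINT IS ON THE FIBRE**: `Ū(V′_{Y_g}·V^{(k)})(c) = Ū(V^{(k)})(c)` for `Y_g = recordReparamOf … (recordDt … ρ₀) Vk g (C·y)`, `‖↑(g·C·y)‖ < ρ₀` — print's «B′ = B − hD̃(B),
B = g_kCB_rem parametrises δ(Q̃(B′))'s fibre» at the record's names (✓`recordQt_eq_zero_iff` inside the `1∕50`-window). [cite: Balaban1987RG1, p.267–268, (2.4) p.266] -/
theorem avg_pert_recordReparamOf_recordCopFluct_eq {k K : ℕ} (hk : k + 1 ≤ (F.P K).m + (F.P K).K) (Vk : GaugeField (F.P K) k (SU 2)) {α : ℝ}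
    (hα : ∀ (c : PBond (F.P K) (k + 1)) (i : Idx (F.P K)), dist1 (loopHol Vk c i) ≤ α) (hαL : 157 * α < (((F.P K).L : ℝ) ^ ((F.P K).d - 1))⁻¹)
    (g : ℝ) (y : NonB0Idx F k K → ℝ) (hgy : ‖(fun i => ((g • (recordCopFluct F k K Vk *ᵥ y)) i : ℂ))‖ < (min ((1 : ℝ) / (10 ^ 8 * (F.P K).d * (F.P K).L) / 3) (1 / (18 * (2 * 1 / (1 / (10 ^ 8 * (F.P K).d * (F.P K).L)) ^ 2) * ((6 / ((((F.P K).L : ℝ) ^ ((F.P K).d - 1))⁻¹ - 157 * α)) + 1))))) (c : PBond (F.P K) (k + 1)) :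
    (avOfRecord F 2 K k).avg (pert F k K Vk (recordReparamOf F k (fun Vk => recordDt F k K Vk (min ((1 : ℝ) / (10 ^ 8 * (F.P K).d * (F.P K).L) / 3) (1 / (18 * (2 * 1 / (1 / (10 ^ 8 * (F.P K).d * (F.P K).L)) ^ 2) * ((6 / ((((F.P K).L : ℝ) ^ ((F.P K).d - 1))⁻¹ - 157 * α)) + 1))))) Vk g (recordCopFluct F k K Vk *ᵥ y))) c = (avOfRecord F 2 K k).avg Vk c := by
  have hα50 : α ≤ 1 / 50 := alpha_le_fiftieth_of_lt F K hαL
  have hα24 : α ≤ 1 / 24 := hα50.trans (by norm_num)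
  have hθ : 0 < (((F.P K).L : ℝ) ^ ((F.P K).d - 1))⁻¹ - 157 * α := sub_pos.2 hαL
  have hb : (0 : ℝ) ≤ 6 / ((((F.P K).L : ℝ) ^ ((F.P K).d - 1))⁻¹ - 157 * α) := by positivity
  have hd : (1 : ℝ) ≤ (F.P K).d := by exact_mod_cast (F.P K).hd
  have hL : (1 : ℝ) ≤ (F.P K).L := by exact_mod_cast (F.P K).hL.2.le
  have hR : (0 : ℝ) < 1 / (10 ^ 8 * (F.P K).d * (F.P K).L) := by positivity
  have hC₂ : (0 : ℝ) < 2 * 1 / (1 / (10 ^ 8 * (F.P K).d * (F.P K).L)) ^ 2 := by positivity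
  obtain ⟨_, hq, h3⟩ := recordDt_smallness_of_radius hR hC₂ hb
  have hε := norm_loopM_sub_one_le_of_dist1 F Vk hα
  have hVk := small_of_dist1_le F Vk hα hα50
  have hHop := norm_hopLinGraphC_le F k K hk Vk hα hα24 hαL
  have hY2 := norm_ofReal_recordReparamOf_recordDt_lt hk Vk hε hα50 hVk hb hHop hq h3 g (recordCopFluct F k K Vk *ᵥ y) hgy
  have hYR : ‖(recordReparamOf F k (fun Vk => recordDt F k K Vk (min ((1 : ℝ) / (10 ^ 8 * (F.P K).d * (F.P K).L) / 3) (1 / (18 * (2 * 1 / (1 / (10 ^ 8 * (F.P K).d * (F.P K).L)) ^ 2) * ((6 / ((((F.P K).L : ℝ) ^ ((F.P K).d - 1))⁻¹ - 157 * α)) + 1))))) Vk g (recordCopFluct F k K Vk *ᵥ y))‖ < 1 / (10 ^ 8 * (F.P K).d * (F.P K).L) := by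
    rw [← norm_ofReal_pi_eq]; linarith [norm_nonneg (fun i => ((g • (recordCopFluct F k K Vk *ᵥ y)) i : ℂ))]
  refine avg_eq_of_recordQt_eq_zero F k K Vk _ c ?_ (recordQt_recordReparamOf_recordCopFluct_eq_zero hk Vk hα hαL g y hgy c)
  linarith [norm_avg_pert_mul_inv_sub_one_le F k K hk Vk hε hα50 hVk _ hYR c]

end Summit.QuantumFields.YangMills.Theorems.BalabanUVNodesPortS1

end
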